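import Literature.Analysis.Calculus.BCHProductLowOrder
import Literature.Analysis.Complex.RungeUnits
import Literature.MathematicalPhysics.QuantumFieldTheory.Balaban1983to89.B11Eq31V4Bound

/-!
# Bałaban, CMP **102** (1985) 277–309 [B11] — (34) p. 283 WITH ITS TAIL: the third-order Baker–Campbell–Hausdorff
expansion of the four-bond product `Π_{b⊂(∂p)_z} exp iηA′(b)` as ONE exponential, the «+ …» bounded by `O(η⁴|A′|⁴)`

statement-level skeleton of published theorems with citation tags; proofs where landed; nothing here is a claim about the
Yang–Mills mass gap

PDF held: `paper:balaban1985-cmp102-variational-background` (journal page = PDF page + 276); p. 283 (34) read from the text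
layer and from r08's verbatim transcription in `B11Eq34BCH` (render `…-p007-x2.png`).

CITATION HEADER (lean-in-tree rule).  Cell `lit-balaban` (HOME `run/shared/lean/pub/lit-balaban/`), seat `lit-balaban-r04`
gen 8 (B7 owner, acting on a free target of row `B11.Eq34`, owner r08).  WHAT IS PRINTED (p. 283, verbatim, as in
`B11Eq34BCH`): «From the Baker-Cambell-Hausdorff formula we have
`∂₀U₁((p)_z) = exp iηR(U₀(x,w))A(z,w) exp iηA(w,x) exp iηA(x,y)·exp iηR(U₀(x,y))A(y,z) = Π_{b⊂(∂p)_z} exp iηA′(b)`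
`= exp{iηΣ_b A′(b) + ½i²η² Σ_{b₁≺b₂}[A′(b₁), A′(b₂)]`
`+ (1/12)i³η³ Σ_{b₁≺b₂}([A′(b₁), [A′(b₁), A′(b₂)]] + [[A′(b₁), A′(b₂)], A′(b₂)])`
`+ (1/6)i³η³ Σ_{b₁≺b₂≺b₃}([A′(b₁), [A′(b₂), A′(b₃)]] + [[A′(b₁), A′(b₂)], A′(b₃)]) + …}. (34)`».

WHAT THE TREE HAD.  r08's `B11Eq34BCH` proves the FORMAL content of (34) through the third order (`bch4_degree2`,
`bch4_degree3`: the homogeneous components of degrees `≤ 3` of `Πe^{Yᵢ}` are those of the exponential of the displayed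
polynomial `Z1 + ½comm2 + (1/12)comm3pair + (1/6)comm3triple`) and records as HONEST SCOPE: «The ANALYTIC statement
behind «+ …» in (34) (convergence of the BCH series, or a fourth-order remainder bound for `log Π e^{Yᵢ}`) is NOT proved
here».  THIS FILE proves that analytic statement, from the generic `Literature.Analysis.Calculus.BCHProductLowOrder`
(third-order BCH for a product of exponentials with an `n`-independent fourth-order tail).

WHAT THIS FILE PROVES (kernel, sorry-free; `𝔸` a complete normed `ℂ`-algebra, `log` = the series `logOnePlus (· − 1)` =
`MatrixLog.mlog`; r08's letters `Z1`, `comm2`, `comm3pair`, `comm3triple` of `B11Eq34BCH`).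
* §1 `bch3List_eq` — the generic list polynomial `BCH.bch3List [Y₁,Y₂,Y₃,Y₄]` IS r08's displayed exponent
  `Z1 + ½comm2 + (1/12)comm3pair + (1/6)comm3triple` (definitionally, term by term); the homogeneity of the four pieces
  under `Yᵢ ↦ cYᵢ` (degrees `1, 2, 3, 3`) is r08's `B11Eq31V4Bound.Z1_smul` / `comm2_smul` / `comm3pair_smul` /
  `comm3triple_smul`, used BY NAME.
* §2 **`eq34_log`** / **`eq34`** — (34) WITH ITS TAIL for four letters `Y₁ ≺ Y₂ ≺ Y₃ ≺ Y₄` with `Σ‖Yᵢ‖ ≤ 1/10`: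
  `‖log(e^{Y₁}e^{Y₂}e^{Y₃}e^{Y₄}) − (Z1 + ½comm2 + (1/12)comm3pair + (1/6)comm3triple)‖ ≤ 30000(Σ‖Yᵢ‖)⁴` and
  `e^{Y₁}e^{Y₂}e^{Y₃}e^{Y₄} = exp{Z1 + ½comm2 + (1/12)comm3pair + (1/6)comm3triple + R}`, `‖R‖ ≤ 30000(Σ‖Yᵢ‖)⁴`.
* §3 **`eq34_printed`** — the same in print's scaling `Yᵢ = iηA′(bᵢ)`, the powers `iη`, `i²η²`, `i³η³` displayed as in
  (34): `Πexp(iηA′ᵢ) = exp{iηZ1(A′) + ½(iη)²comm2(A′) + (1/12)(iη)³comm3pair(A′) + (1/6)(iη)³comm3triple(A′) + R}`,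
  `‖R‖ ≤ 30000η⁴(Σ|A′(bᵢ)|)⁴` for `ηΣ|A′(bᵢ)| ≤ 1/10`; **`eq34_Aprime`** — at the four plaquette letters
  `A′(⟨z,w⟩) ≺ A′(⟨w,x⟩) ≺ A′(⟨x,y⟩) ≺ A′(⟨y,z⟩)` = r08's `B11Eq34BCH.Aprime U₀ A μ ν x` (`Σ_b A′(b) = η(D^η_{U₀}A)(p)`
  by `B11Eq34BCH.Z1_Aprime` / `B8Eq146AExpansion.lin_eq_smul_plaqCovDeriv`).
* §4 `eq34_covPlaqF` — the same expansion for the `x`-based plaquette variable `(∂_{U₀}e^{B})(p_{μν}(x)) =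
  e^{X₁}e^{X₂}e^{X₃}e^{X₄}` of [6] (1.22)/(1.47) (`B8Eq146AExpansion.covPlaqF_expCfg`, letters `X₁ ≺ X₂ ≺ X₃ ≺ X₄`),
  for ANY exponent field `B` and ANY background `U₀`, smallness `Σ‖Xᵢ‖ ≤ 1/10`.
* §5 (v1.1) PRINT'S REGIME EXACTLY — (32) with «for simplicity `32ε₂ ≤ 1`», which the line before (33) turns into
  `e^{η|A|(∂p)} < e^{4ε₂} < 2`: **`eq34_printed_regime32`** (`η ≥ 0`, `32ε₂ ≤ 1`, `ηΣᵢ|A′ᵢ| ≤ 4ε₂` ⇒ (34) with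
  `‖R‖ ≤ 40000η⁴(Σ|A′ᵢ|)⁴`), `eq34_eighth` / `eq34_Aprime_regime32` / `eq34_covPlaqF_eighth` (threshold `1/8`), from the
  generic v1.1 `BCH.prodExp_eq_exp_bch3List_add_eighth`.
* §6 (v1.2) **`eq34_prod_sub_exp_regime32`** — the plaquette variable ITSELF versus the exponential of (34)'s displayed
  polynomial: `‖Πexp(iηA′ᵢ) − exp{displayed}‖ ≤ 52000η⁴(Σ|A′ᵢ|)⁴` on print's regime (for `‖1‖ = 1`; local Lipschitz bound of
  `exp`, `Literature.Analysis.Complex.norm_exp_sub_exp_le`, with `‖log Π‖ ≤ (4/3)ηΣ|A′ᵢ|` from the generic v1.2) — the form in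
  which (34) enters (35)–(36); `prod_sub_exp_eighth` (four letters), `eq34_Aprime_prod_sub_exp_regime32`.

HONEST SCOPE.  (i) The constants `30000` / `40000` are admissible witnesses of print's «…» (an `O(η⁴|A|⁴)` tail), not
optimal; §§2–4 use the threshold `1/10`, §5 (v1.1) print's whole regime `η|A′|(∂p) ≤ 4ε₂ ≤ 1/8` ((32), `32ε₂ ≤ 1`), stated on
the letters `A′ᵢ` (`|A′(b)| = |A(b)|` when the background is unitary; in a general normed algebra the hypothesis is on
`‖A′ᵢ‖` as displayed).  (ii) Nothing of (35)–(36) is touched: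
the identification of `V⁽³⁾` uses only the formal third-order content (r08's `bch4_degree3`, `B11Eq26ActionExpansion`,
`B11Eq36Complex`); r08's `B11Eq31V4Bound` bounds the TAYLOR fourth-order remainder `V₄` of (29)–(31)/(35) — a different
object from the BCH tail `R` here (the remainder INSIDE the exponent).  (iii) `∂₀U₁((p)_z)` is print's `z`-based holonomy = the ordered product of the four displayed
exponentials; §4 treats [6]'s `x`-based `covPlaqF` (a cyclic relabelling of the letters), §3 the `z`-based letters.  No
`def … : Prop`, no new named fact; definitions none; theorems only.  Row `B11.Eq34` (owner r08) — head unchanged by this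
seat; a rider «(34)'s tail `+…` bounded: `B11Eq34Analytic.eq34_printed`» is offered to the owner.
v1.3 (unit `lit-balaban-r04` gen 20, DOCSTRING-ONLY; every declaration byte-identical with v1.2 p306335): the three §6
`[cite:]` tags read "(34)–(36) p.283"; on the text layer (`p0007.txt` L17/L20, `p0008.txt` L3) (34) and (35) are p. 283 and
(36) opens p. 284 — corrected to "(34)–(35) p.283, (36) p.284" (r08 g13 CITELOC INFO, seat INBOX 2026-08-22T03:12:52Z).
-/

noncomputable section

open NormedSpace
open Literature.Analysis.Complex (logOnePlus)
open Literature.Analysis.Calculus.BCH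

namespace Literature.MathematicalPhysics.QuantumFieldTheory.Balaban1983to89.B11Eq34Analytic

open B11Eq34BCH (Z1 comm2 comm3pair comm3triple Aprime)

/-! ## §1 The generic list polynomial at four letters is the displayed exponent of (34) -/

section Algebra

variable {𝔸 : Type*} [NormedRing 𝔸] [NormedAlgebra ℂ 𝔸]

/-- `bch3List [Y₁,Y₂,Y₃,Y₄] = Z1 + ½comm2 + (1/12)comm3pair + (1/6)comm3triple` — the generic cubic BCH polynomial of an
ordered four-letter list is, term by term, the exponent displayed in (34). [cite: Balaban1985Variational, (34) p.283] -/
theorem bch3List_eq (Y₁ Y₂ Y₃ Y₄ : 𝔸) :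
    bch3List [Y₁, Y₂, Y₃, Y₄] = Z1 Y₁ Y₂ Y₃ Y₄ + (2 : ℂ)⁻¹ • comm2 Y₁ Y₂ Y₃ Y₄ +
      (12 : ℂ)⁻¹ • comm3pair Y₁ Y₂ Y₃ Y₄ + (6 : ℂ)⁻¹ • comm3triple Y₁ Y₂ Y₃ Y₄ := by
  rw [bch3List_four]
  rfl

omit [NormedAlgebra ℂ 𝔸] in
/-- The four-letter size: `ns [Y₁,Y₂,Y₃,Y₄] = Σ‖Yᵢ‖`. [cite: Balaban1985Variational, (34) p.283] -/
theorem ns_four (Y₁ Y₂ Y₃ Y₄ : 𝔸) : ns [Y₁, Y₂, Y₃, Y₄] = ‖Y₁‖ + ‖Y₂‖ + ‖Y₃‖ + ‖Y₄‖ := by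
  simp [add_assoc]

end Algebra

/-! ## §2 (34) with its tail, for four letters -/

section Four

variable {𝔸 : Type*} [NormedRing 𝔸] [NormedAlgebra ℂ 𝔸] [CompleteSpace 𝔸]

/-- **(34) WITH ITS TAIL, logarithmic form**: for `Σ‖Yᵢ‖ ≤ 1/10`,
`‖log(e^{Y₁}e^{Y₂}e^{Y₃}e^{Y₄}) − (Z1 + ½comm2 + (1/12)comm3pair + (1/6)comm3triple)‖ ≤ 30000(Σ‖Yᵢ‖)⁴`.
[cite: Balaban1985Variational, (34) p.283] -/
theorem eq34_log (Y₁ Y₂ Y₃ Y₄ : 𝔸) (h : ‖Y₁‖ + ‖Y₂‖ + ‖Y₃‖ + ‖Y₄‖ ≤ 1 / 10) :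
    ‖logOnePlus (exp Y₁ * exp Y₂ * exp Y₃ * exp Y₄ - 1) -
        (Z1 Y₁ Y₂ Y₃ Y₄ + (2 : ℂ)⁻¹ • comm2 Y₁ Y₂ Y₃ Y₄ + (12 : ℂ)⁻¹ • comm3pair Y₁ Y₂ Y₃ Y₄ +
          (6 : ℂ)⁻¹ • comm3triple Y₁ Y₂ Y₃ Y₄)‖ ≤ 30000 * (‖Y₁‖ + ‖Y₂‖ + ‖Y₃‖ + ‖Y₄‖) ^ 4 := by
  rw [← bch3List_eq]
  exact norm_log_prodExp_four_sub_le Y₁ Y₂ Y₃ Y₄ h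

/-- **(34) WITH ITS TAIL**: for `Σ‖Yᵢ‖ ≤ 1/10` there is `R` with
`e^{Y₁}e^{Y₂}e^{Y₃}e^{Y₄} = exp{Z1 + ½comm2 + (1/12)comm3pair + (1/6)comm3triple + R}` and `‖R‖ ≤ 30000(Σ‖Yᵢ‖)⁴` —
print's «+ …». [cite: Balaban1985Variational, (34) p.283] -/
theorem eq34 (Y₁ Y₂ Y₃ Y₄ : 𝔸) (h : ‖Y₁‖ + ‖Y₂‖ + ‖Y₃‖ + ‖Y₄‖ ≤ 1 / 10) :
    ∃ R : 𝔸, exp Y₁ * exp Y₂ * exp Y₃ * exp Y₄ =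
        exp (Z1 Y₁ Y₂ Y₃ Y₄ + (2 : ℂ)⁻¹ • comm2 Y₁ Y₂ Y₃ Y₄ + (12 : ℂ)⁻¹ • comm3pair Y₁ Y₂ Y₃ Y₄ +
          (6 : ℂ)⁻¹ • comm3triple Y₁ Y₂ Y₃ Y₄ + R) ∧
      ‖R‖ ≤ 30000 * (‖Y₁‖ + ‖Y₂‖ + ‖Y₃‖ + ‖Y₄‖) ^ 4 := by
  have hns : ns [Y₁, Y₂, Y₃, Y₄] = ‖Y₁‖ + ‖Y₂‖ + ‖Y₃‖ + ‖Y₄‖ := ns_four _ _ _ _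
  obtain ⟨R, hR, hRle⟩ := prodExp_eq_exp_bch3List_add [Y₁, Y₂, Y₃, Y₄] (by rw [hns]; exact h)
  refine ⟨R, ?_, by rwa [hns] at hRle⟩
  rw [← bch3List_eq, ← hR]
  simp [mul_assoc]

end Four

/-! ## §3 In print's scaling `Yᵢ = iηA′(bᵢ)`: the powers `iη`, `i²η²`, `i³η³` -/

section Printed

variable {𝔸 : Type*} [NormedRing 𝔸] [NormedAlgebra ℂ 𝔸] [CompleteSpace 𝔸]

omit [CompleteSpace 𝔸] in
/-- `‖iηA‖ = η‖A‖` for `η ≥ 0`. [cite: Balaban1985Variational, (32) p.282] -/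
theorem norm_ieta_smul {η : ℝ} (hη : 0 ≤ η) (A : 𝔸) : ‖((Complex.I : ℂ) * η) • A‖ = η * ‖A‖ := by
  rw [norm_smul, norm_mul, Complex.norm_I, one_mul, Complex.norm_real, Real.norm_of_nonneg hη]

/-- **(34) AS PRINTED, WITH ITS TAIL**: for `η ≥ 0` and `η(Σᵢ|A′ᵢ|) ≤ 1/10` there is `R` with
`exp(iηA′₁)exp(iηA′₂)exp(iηA′₃)exp(iηA′₄) = exp{iηΣA′ᵢ + ½i²η²Σ_{i≺j}[A′ᵢ,A′ⱼ]`
`+ (1/12)i³η³Σ_{i≺j}([A′ᵢ,[A′ᵢ,A′ⱼ]] + [[A′ᵢ,A′ⱼ],A′ⱼ]) + (1/6)i³η³Σ_{i≺j≺k}([A′ᵢ,[A′ⱼ,A′ₖ]] + [[A′ᵢ,A′ⱼ],A′ₖ]) + R}`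
and `‖R‖ ≤ 30000·η⁴(Σ|A′ᵢ|)⁴` — the «+ …» of (34) is `O(η⁴|A′|⁴)`. [cite: Balaban1985Variational, (34) p.283] -/
theorem eq34_printed (A₁ A₂ A₃ A₄ : 𝔸) {η : ℝ} (hη : 0 ≤ η)
    (h : η * (‖A₁‖ + ‖A₂‖ + ‖A₃‖ + ‖A₄‖) ≤ 1 / 10) :
    ∃ R : 𝔸,
      exp (((Complex.I : ℂ) * η) • A₁) * exp (((Complex.I : ℂ) * η) • A₂) * exp (((Complex.I : ℂ) * η) • A₃) *
          exp (((Complex.I : ℂ) * η) • A₄) =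
        exp (((Complex.I : ℂ) * η) • Z1 A₁ A₂ A₃ A₄ + (2 : ℂ)⁻¹ • ((Complex.I : ℂ) * η) ^ 2 • comm2 A₁ A₂ A₃ A₄ +
          (12 : ℂ)⁻¹ • ((Complex.I : ℂ) * η) ^ 3 • comm3pair A₁ A₂ A₃ A₄ +
          (6 : ℂ)⁻¹ • ((Complex.I : ℂ) * η) ^ 3 • comm3triple A₁ A₂ A₃ A₄ + R) ∧
      ‖R‖ ≤ 30000 * η ^ 4 * (‖A₁‖ + ‖A₂‖ + ‖A₃‖ + ‖A₄‖) ^ 4 := by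
  set c : ℂ := (Complex.I : ℂ) * η with hc
  have hsum : ‖c • A₁‖ + ‖c • A₂‖ + ‖c • A₃‖ + ‖c • A₄‖ = η * (‖A₁‖ + ‖A₂‖ + ‖A₃‖ + ‖A₄‖) := by
    simp only [hc, norm_ieta_smul hη]; ring
  obtain ⟨R, hR, hRle⟩ := eq34 (c • A₁) (c • A₂) (c • A₃) (c • A₄) (by rw [hsum]; exact h)
  refine ⟨R, ?_, ?_⟩
  · rw [hR, B11Eq31V4Bound.Z1_smul, B11Eq31V4Bound.comm2_smul, B11Eq31V4Bound.comm3pair_smul,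
      B11Eq31V4Bound.comm3triple_smul]
  · calc ‖R‖ ≤ 30000 * (‖c • A₁‖ + ‖c • A₂‖ + ‖c • A₃‖ + ‖c • A₄‖) ^ 4 := hRle
      _ = 30000 * η ^ 4 * (‖A₁‖ + ‖A₂‖ + ‖A₃‖ + ‖A₄‖) ^ 4 := by rw [hsum]; ring

variable {d : ℕ}

/-- **(34) AT THE PLAQUETTE LETTERS**: with `A′(⟨z,w⟩) ≺ A′(⟨w,x⟩) ≺ A′(⟨x,y⟩) ≺ A′(⟨y,z⟩)` the letters
`B11Eq34BCH.Aprime U₀ A μ ν x` of r08's dictionary (`Σ_b A′(b) = η(D^η_{U₀}A)(p)`, `B11Eq34BCH.Z1_Aprime`), for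
`ηΣ_b|A′(b)| ≤ 1/10`: `Π_{b⊂(∂p)_z} exp iηA′(b) = exp{(34)'s displayed exponent + R}`, `‖R‖ ≤ 30000η⁴(Σ_b|A′(b)|)⁴`.
[cite: Balaban1985Variational, (34) p.283] -/
theorem eq34_Aprime (U₀ : B7Prop1Explicit.Site d → Fin d → 𝔸ˣ) (A : B7Prop1Explicit.Site d → Fin d → 𝔸)
    (μ ν : Fin d) (x : B7Prop1Explicit.Site d) {η : ℝ}
    (hη : 0 ≤ η)
    (h : η * (‖Aprime U₀ A μ ν x 0‖ + ‖Aprime U₀ A μ ν x 1‖ + ‖Aprime U₀ A μ ν x 2‖ + ‖Aprime U₀ A μ ν x 3‖)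
      ≤ 1 / 10) :
    ∃ R : 𝔸,
      exp (((Complex.I : ℂ) * η) • Aprime U₀ A μ ν x 0) * exp (((Complex.I : ℂ) * η) • Aprime U₀ A μ ν x 1) *
          exp (((Complex.I : ℂ) * η) • Aprime U₀ A μ ν x 2) * exp (((Complex.I : ℂ) * η) • Aprime U₀ A μ ν x 3) =
        exp (((Complex.I : ℂ) * η) •
              Z1 (Aprime U₀ A μ ν x 0) (Aprime U₀ A μ ν x 1) (Aprime U₀ A μ ν x 2) (Aprime U₀ A μ ν x 3) +
          (2 : ℂ)⁻¹ • ((Complex.I : ℂ) * η) ^ 2 •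
              comm2 (Aprime U₀ A μ ν x 0) (Aprime U₀ A μ ν x 1) (Aprime U₀ A μ ν x 2) (Aprime U₀ A μ ν x 3) +
          (12 : ℂ)⁻¹ • ((Complex.I : ℂ) * η) ^ 3 •
              comm3pair (Aprime U₀ A μ ν x 0) (Aprime U₀ A μ ν x 1) (Aprime U₀ A μ ν x 2) (Aprime U₀ A μ ν x 3) +
          (6 : ℂ)⁻¹ • ((Complex.I : ℂ) * η) ^ 3 •
              comm3triple (Aprime U₀ A μ ν x 0) (Aprime U₀ A μ ν x 1) (Aprime U₀ A μ ν x 2)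
                (Aprime U₀ A μ ν x 3) + R) ∧
      ‖R‖ ≤ 30000 * η ^ 4 *
        (‖Aprime U₀ A μ ν x 0‖ + ‖Aprime U₀ A μ ν x 1‖ + ‖Aprime U₀ A μ ν x 2‖ + ‖Aprime U₀ A μ ν x 3‖) ^ 4 :=
  eq34_printed _ _ _ _ hη h

end Printed

/-! ## §4 The same for [6]'s `x`-based plaquette variable `(∂_{U₀}e^B)(p_{μν}(x)) = e^{X₁}e^{X₂}e^{X₃}e^{X₄}` -/

section CovPlaq

open B8Eq146AExpansion (X1 X2 X3 X4)

variable {d : ℕ} {𝔸 : Type*} [NormedRing 𝔸] [NormedAlgebra ℂ 𝔸] [CompleteSpace 𝔸]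

/-- **Third-order BCH of the plaquette variable** `(∂_{U₀}e^{B})(p_{μν}(x)) = e^{X₁}e^{X₂}e^{X₃}e^{X₄}` ([6] (1.22) with
(1.41), `B8Eq146AExpansion.covPlaqF_expCfg`; letters `X₁ = B(x,y) ≺ X₂ = R(U₀(x,y))B(y,z) ≺ X₃ = R(U₀(x,w))B(z,w) ≺
X₄ = B(w,x)`), for ANY background `U₀` and exponent field `B` with `Σ‖Xᵢ‖ ≤ 1/10`:
`(∂_{U₀}e^{B})(p) = exp{bch3List [X₁,X₂,X₃,X₄] + R}`, `‖R‖ ≤ 30000(Σ‖Xᵢ‖)⁴` (`bch3List [X₁,…,X₄]` written out in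
`BCH.bch3List_four`: the exponent of (34) in these letters). [cite: Balaban1985Variational, (34) p.283] -/
theorem eq34_covPlaqF (U₀ : B7Prop1Explicit.Site d → Fin d → 𝔸ˣ) (B : B7Prop1Explicit.Site d → Fin d → 𝔸)
    (μ ν : Fin d) (x : B7Prop1Explicit.Site d)
    (h : ‖X1 B μ x‖ + ‖X2 U₀ B μ ν x‖ + ‖X3 U₀ B μ ν x‖ + ‖X4 B ν x‖ ≤ 1 / 10) :
    ∃ R : 𝔸, (B8Eq143PlaqExpansion.covPlaqF U₀ (B8Eq146AExpansion.expCfg B) μ ν x : 𝔸) =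
        exp (bch3List [X1 B μ x, X2 U₀ B μ ν x, X3 U₀ B μ ν x, X4 B ν x] + R) ∧
      ‖R‖ ≤ 30000 * (‖X1 B μ x‖ + ‖X2 U₀ B μ ν x‖ + ‖X3 U₀ B μ ν x‖ + ‖X4 B ν x‖) ^ 4 := by
  have hns : ns [X1 B μ x, X2 U₀ B μ ν x, X3 U₀ B μ ν x, X4 B ν x] =
      ‖X1 B μ x‖ + ‖X2 U₀ B μ ν x‖ + ‖X3 U₀ B μ ν x‖ + ‖X4 B ν x‖ := ns_four _ _ _ _
  obtain ⟨R, hR, hRle⟩ :=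
    prodExp_eq_exp_bch3List_add [X1 B μ x, X2 U₀ B μ ν x, X3 U₀ B μ ν x, X4 B ν x] (by rw [hns]; exact h)
  refine ⟨R, ?_, by rwa [hns] at hRle⟩
  rw [B8Eq146AExpansion.covPlaqF_expCfg, ← hR]
  simp [mul_assoc]

end CovPlaq

/-! ## §5 (v1.1) Print's regime EXACTLY: `η|A′|(∂p) ≤ 4ε₂`, `32ε₂ ≤ 1` -/

section Regime32

variable {𝔸 : Type*} [NormedRing 𝔸] [NormedAlgebra ℂ 𝔸] [CompleteSpace 𝔸]

/-- **(34) WITH ITS TAIL up to `Σ‖Yᵢ‖ ≤ 1/8`**: `e^{Y₁}e^{Y₂}e^{Y₃}e^{Y₄} = exp{Z1 + ½comm2 + (1/12)comm3pair +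
(1/6)comm3triple + R}`, `‖R‖ ≤ 40000(Σ‖Yᵢ‖)⁴` (generic `BCH.prodExp_eq_exp_bch3List_add_eighth`).
[cite: Balaban1985Variational, (32)–(34) pp.282–283] -/
theorem eq34_eighth (Y₁ Y₂ Y₃ Y₄ : 𝔸) (h : ‖Y₁‖ + ‖Y₂‖ + ‖Y₃‖ + ‖Y₄‖ ≤ 1 / 8) :
    ∃ R : 𝔸, exp Y₁ * exp Y₂ * exp Y₃ * exp Y₄ =
        exp (Z1 Y₁ Y₂ Y₃ Y₄ + (2 : ℂ)⁻¹ • comm2 Y₁ Y₂ Y₃ Y₄ + (12 : ℂ)⁻¹ • comm3pair Y₁ Y₂ Y₃ Y₄ +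
          (6 : ℂ)⁻¹ • comm3triple Y₁ Y₂ Y₃ Y₄ + R) ∧
      ‖R‖ ≤ 40000 * (‖Y₁‖ + ‖Y₂‖ + ‖Y₃‖ + ‖Y₄‖) ^ 4 := by
  have hns : ns [Y₁, Y₂, Y₃, Y₄] = ‖Y₁‖ + ‖Y₂‖ + ‖Y₃‖ + ‖Y₄‖ := ns_four _ _ _ _
  obtain ⟨R, hR, hRle⟩ := prodExp_eq_exp_bch3List_add_eighth [Y₁, Y₂, Y₃, Y₄] (by rw [hns]; exact h)
  refine ⟨R, ?_, by rwa [hns] at hRle⟩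
  rw [← bch3List_eq, ← hR]
  simp [mul_assoc]

/-- **(34) AS PRINTED, IN PRINT'S REGIME (32) WITH «`32ε₂ ≤ 1`»**: for `η ≥ 0`, `32ε₂ ≤ 1` and
`η(Σᵢ|A′ᵢ|) ≤ 4ε₂` — print's `e^{η|A|(∂p)} < e^{4ε₂} < 2` (line before (33); `|A′(b)| = |A(b)|` for a unitary
background) — there is `R` with
`exp(iηA′₁)exp(iηA′₂)exp(iηA′₃)exp(iηA′₄) = exp{iηΣA′ᵢ + ½i²η²Σ_{i≺j}[A′ᵢ,A′ⱼ]`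
`+ (1/12)i³η³Σ_{i≺j}([A′ᵢ,[A′ᵢ,A′ⱼ]] + [[A′ᵢ,A′ⱼ],A′ⱼ]) + (1/6)i³η³Σ_{i≺j≺k}([A′ᵢ,[A′ⱼ,A′ₖ]] + [[A′ᵢ,A′ⱼ],A′ₖ]) + R}`
and `‖R‖ ≤ 40000·η⁴(Σ|A′ᵢ|)⁴` — the «+ …» of (34) is `O(η⁴|A′|⁴)` on the whole printed regime.
[cite: Balaban1985Variational, (32)–(34) pp.282–283] -/
theorem eq34_printed_regime32 (A₁ A₂ A₃ A₄ : 𝔸) {η ε₂ : ℝ} (hη : 0 ≤ η) (hε : 32 * ε₂ ≤ 1)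
    (h : η * (‖A₁‖ + ‖A₂‖ + ‖A₃‖ + ‖A₄‖) ≤ 4 * ε₂) :
    ∃ R : 𝔸,
      exp (((Complex.I : ℂ) * η) • A₁) * exp (((Complex.I : ℂ) * η) • A₂) * exp (((Complex.I : ℂ) * η) • A₃) *
          exp (((Complex.I : ℂ) * η) • A₄) =
        exp (((Complex.I : ℂ) * η) • Z1 A₁ A₂ A₃ A₄ + (2 : ℂ)⁻¹ • ((Complex.I : ℂ) * η) ^ 2 • comm2 A₁ A₂ A₃ A₄ +
          (12 : ℂ)⁻¹ • ((Complex.I : ℂ) * η) ^ 3 • comm3pair A₁ A₂ A₃ A₄ +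
          (6 : ℂ)⁻¹ • ((Complex.I : ℂ) * η) ^ 3 • comm3triple A₁ A₂ A₃ A₄ + R) ∧
      ‖R‖ ≤ 40000 * η ^ 4 * (‖A₁‖ + ‖A₂‖ + ‖A₃‖ + ‖A₄‖) ^ 4 := by
  set c : ℂ := (Complex.I : ℂ) * η with hc
  have hsum : ‖c • A₁‖ + ‖c • A₂‖ + ‖c • A₃‖ + ‖c • A₄‖ = η * (‖A₁‖ + ‖A₂‖ + ‖A₃‖ + ‖A₄‖) := by
    simp only [hc, norm_ieta_smul hη]; ring
  obtain ⟨R, hR, hRle⟩ := eq34_eighth (c • A₁) (c • A₂) (c • A₃) (c • A₄) (by rw [hsum]; linarith)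
  refine ⟨R, ?_, ?_⟩
  · rw [hR, B11Eq31V4Bound.Z1_smul, B11Eq31V4Bound.comm2_smul, B11Eq31V4Bound.comm3pair_smul,
      B11Eq31V4Bound.comm3triple_smul]
  · calc ‖R‖ ≤ 40000 * (‖c • A₁‖ + ‖c • A₂‖ + ‖c • A₃‖ + ‖c • A₄‖) ^ 4 := hRle
      _ = 40000 * η ^ 4 * (‖A₁‖ + ‖A₂‖ + ‖A₃‖ + ‖A₄‖) ^ 4 := by rw [hsum]; ring

variable {d : ℕ}

/-- **(34) AT THE PLAQUETTE LETTERS, PRINT'S REGIME**: letters `B11Eq34BCH.Aprime U₀ A μ ν x 0..3`, `η ≥ 0`,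
`32ε₂ ≤ 1`, `ηΣ_b|A′(b)| ≤ 4ε₂`: `Π_{b⊂(∂p)_z} exp iηA′(b) = exp{(34)'s displayed exponent + R}`,
`‖R‖ ≤ 40000η⁴(Σ_b|A′(b)|)⁴`. [cite: Balaban1985Variational, (32)–(34) pp.282–283] -/
theorem eq34_Aprime_regime32 (U₀ : B7Prop1Explicit.Site d → Fin d → 𝔸ˣ) (A : B7Prop1Explicit.Site d → Fin d → 𝔸)
    (μ ν : Fin d) (x : B7Prop1Explicit.Site d) {η ε₂ : ℝ} (hη : 0 ≤ η) (hε : 32 * ε₂ ≤ 1)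
    (h : η * (‖Aprime U₀ A μ ν x 0‖ + ‖Aprime U₀ A μ ν x 1‖ + ‖Aprime U₀ A μ ν x 2‖ + ‖Aprime U₀ A μ ν x 3‖)
      ≤ 4 * ε₂) :
    ∃ R : 𝔸,
      exp (((Complex.I : ℂ) * η) • Aprime U₀ A μ ν x 0) * exp (((Complex.I : ℂ) * η) • Aprime U₀ A μ ν x 1) *
          exp (((Complex.I : ℂ) * η) • Aprime U₀ A μ ν x 2) * exp (((Complex.I : ℂ) * η) • Aprime U₀ A μ ν x 3) =
        exp (((Complex.I : ℂ) * η) •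
              Z1 (Aprime U₀ A μ ν x 0) (Aprime U₀ A μ ν x 1) (Aprime U₀ A μ ν x 2) (Aprime U₀ A μ ν x 3) +
          (2 : ℂ)⁻¹ • ((Complex.I : ℂ) * η) ^ 2 •
              comm2 (Aprime U₀ A μ ν x 0) (Aprime U₀ A μ ν x 1) (Aprime U₀ A μ ν x 2) (Aprime U₀ A μ ν x 3) +
          (12 : ℂ)⁻¹ • ((Complex.I : ℂ) * η) ^ 3 •
              comm3pair (Aprime U₀ A μ ν x 0) (Aprime U₀ A μ ν x 1) (Aprime U₀ A μ ν x 2) (Aprime U₀ A μ ν x 3) +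
          (6 : ℂ)⁻¹ • ((Complex.I : ℂ) * η) ^ 3 •
              comm3triple (Aprime U₀ A μ ν x 0) (Aprime U₀ A μ ν x 1) (Aprime U₀ A μ ν x 2)
                (Aprime U₀ A μ ν x 3) + R) ∧
      ‖R‖ ≤ 40000 * η ^ 4 *
        (‖Aprime U₀ A μ ν x 0‖ + ‖Aprime U₀ A μ ν x 1‖ + ‖Aprime U₀ A μ ν x 2‖ + ‖Aprime U₀ A μ ν x 3‖) ^ 4 :=
  eq34_printed_regime32 _ _ _ _ hη hε h

open B8Eq146AExpansion (X1 X2 X3 X4) in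
/-- **Third-order BCH of the plaquette variable** `(∂_{U₀}e^{B})(p_{μν}(x)) = e^{X₁}e^{X₂}e^{X₃}e^{X₄}` up to
`Σ‖Xᵢ‖ ≤ 1/8`: `(∂_{U₀}e^{B})(p) = exp{bch3List [X₁,X₂,X₃,X₄] + R}`, `‖R‖ ≤ 40000(Σ‖Xᵢ‖)⁴`, any `U₀`, `B`.
[cite: Balaban1985Variational, (32)–(34) pp.282–283] -/
theorem eq34_covPlaqF_eighth (U₀ : B7Prop1Explicit.Site d → Fin d → 𝔸ˣ) (B : B7Prop1Explicit.Site d → Fin d → 𝔸)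
    (μ ν : Fin d) (x : B7Prop1Explicit.Site d)
    (h : ‖X1 B μ x‖ + ‖X2 U₀ B μ ν x‖ + ‖X3 U₀ B μ ν x‖ + ‖X4 B ν x‖ ≤ 1 / 8) :
    ∃ R : 𝔸, (B8Eq143PlaqExpansion.covPlaqF U₀ (B8Eq146AExpansion.expCfg B) μ ν x : 𝔸) =
        exp (bch3List [X1 B μ x, X2 U₀ B μ ν x, X3 U₀ B μ ν x, X4 B ν x] + R) ∧
      ‖R‖ ≤ 40000 * (‖X1 B μ x‖ + ‖X2 U₀ B μ ν x‖ + ‖X3 U₀ B μ ν x‖ + ‖X4 B ν x‖) ^ 4 := by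
  have hns : ns [X1 B μ x, X2 U₀ B μ ν x, X3 U₀ B μ ν x, X4 B ν x] =
      ‖X1 B μ x‖ + ‖X2 U₀ B μ ν x‖ + ‖X3 U₀ B μ ν x‖ + ‖X4 B ν x‖ := ns_four _ _ _ _
  obtain ⟨R, hR, hRle⟩ :=
    prodExp_eq_exp_bch3List_add_eighth [X1 B μ x, X2 U₀ B μ ν x, X3 U₀ B μ ν x, X4 B ν x] (by rw [hns]; exact h)
  refine ⟨R, ?_, by rwa [hns] at hRle⟩
  rw [B8Eq146AExpansion.covPlaqF_expCfg, ← hR]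
  simp [mul_assoc]

end Regime32

/-! ## §6 (v1.2) The plaquette variable ITSELF versus the exponential of (34)'s displayed polynomial

For (35)–(36) one expands `∂₀U₁((p)_z) = exp{Z + R}`; since `Z + R = log ∂₀U₁((p)_z)` and `Z` are both small
(`‖Z + R‖ ≤ (4/3)ηΣ|A′ᵢ|`, `‖Z‖ ≤ 2ηΣ|A′ᵢ|`, generic v1.2 `BCH.prodExp_eq_exp_bch3List_add_eighth'`), the local Lipschitz bound of
`exp` (`Literature.Analysis.Complex.norm_exp_sub_exp_le`, which assumes `‖1‖ = 1`) gives
`‖∂₀U₁((p)_z) − exp{Z}‖ ≤ ‖R‖e^{1/4} ≤ 52000η⁴(Σ|A′ᵢ|)⁴` on print's regime. -/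

section ProdSubExp

variable {𝔸 : Type*} [NormedRing 𝔸] [NormedAlgebra ℂ 𝔸] [CompleteSpace 𝔸] [NormOneClass 𝔸]

/-- **Four exponentials versus the exponential of the cubic polynomial**: for `Σ‖Yᵢ‖ ≤ 1/8` (and `‖1‖ = 1`),
`‖e^{Y₁}e^{Y₂}e^{Y₃}e^{Y₄} − exp(Z1 + ½comm2 + (1/12)comm3pair + (1/6)comm3triple)‖ ≤ 52000(Σ‖Yᵢ‖)⁴`.
[cite: Balaban1985Variational, (34)–(35) p.283, (36) p.284] -/
theorem prod_sub_exp_eighth (Y₁ Y₂ Y₃ Y₄ : 𝔸) (h : ‖Y₁‖ + ‖Y₂‖ + ‖Y₃‖ + ‖Y₄‖ ≤ 1 / 8) :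
    ‖exp Y₁ * exp Y₂ * exp Y₃ * exp Y₄ -
        exp (Z1 Y₁ Y₂ Y₃ Y₄ + (2 : ℂ)⁻¹ • comm2 Y₁ Y₂ Y₃ Y₄ + (12 : ℂ)⁻¹ • comm3pair Y₁ Y₂ Y₃ Y₄ +
          (6 : ℂ)⁻¹ • comm3triple Y₁ Y₂ Y₃ Y₄)‖ ≤ 52000 * (‖Y₁‖ + ‖Y₂‖ + ‖Y₃‖ + ‖Y₄‖) ^ 4 := by
  have hns : ns [Y₁, Y₂, Y₃, Y₄] = ‖Y₁‖ + ‖Y₂‖ + ‖Y₃‖ + ‖Y₄‖ := ns_four _ _ _ _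
  obtain ⟨R, hR, hRle, hWle, hZle⟩ := prodExp_eq_exp_bch3List_add_eighth' [Y₁, Y₂, Y₃, Y₄] (by rw [hns]; exact h)
  rw [hns] at hRle hWle hZle
  have hprod : ([Y₁, Y₂, Y₃, Y₄].map exp).prod = exp Y₁ * exp Y₂ * exp Y₃ * exp Y₄ := by simp [mul_assoc]
  rw [← bch3List_eq, ← hprod, hR]
  have hL := Literature.Analysis.Complex.norm_exp_sub_exp_le (bch3List [Y₁, Y₂, Y₃, Y₄] + R) (bch3List [Y₁, Y₂, Y₃, Y₄])
  rw [add_sub_cancel_left] at hL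
  have hmax : max ‖bch3List [Y₁, Y₂, Y₃, Y₄] + R‖ ‖bch3List [Y₁, Y₂, Y₃, Y₄]‖ ≤ 1 / 4 :=
    max_le (by linarith) (by linarith)
  have h0 : 0 ≤ ‖Y₁‖ + ‖Y₂‖ + ‖Y₃‖ + ‖Y₄‖ := by positivity
  calc ‖exp (bch3List [Y₁, Y₂, Y₃, Y₄] + R) - exp (bch3List [Y₁, Y₂, Y₃, Y₄])‖
      ≤ ‖R‖ * Real.exp (max ‖bch3List [Y₁, Y₂, Y₃, Y₄] + R‖ ‖bch3List [Y₁, Y₂, Y₃, Y₄]‖) := hL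
    _ ≤ 40000 * (‖Y₁‖ + ‖Y₂‖ + ‖Y₃‖ + ‖Y₄‖) ^ 4 * Real.exp (1 / 4) := by gcongr
    _ ≤ 40000 * (‖Y₁‖ + ‖Y₂‖ + ‖Y₃‖ + ‖Y₄‖) ^ 4 * 1.3 := by gcongr; exact exp_quarter_le
    _ = 52000 * (‖Y₁‖ + ‖Y₂‖ + ‖Y₃‖ + ‖Y₄‖) ^ 4 := by ring

/-- **`∂₀U₁((p)_z)` VERSUS THE EXPONENTIAL OF (34)'s DISPLAYED POLYNOMIAL, PRINT'S REGIME**: for `η ≥ 0`, `32ε₂ ≤ 1`,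
`η(Σᵢ|A′ᵢ|) ≤ 4ε₂` (and `‖1‖ = 1`):
`‖exp(iηA′₁)exp(iηA′₂)exp(iηA′₃)exp(iηA′₄) − exp{iηΣA′ᵢ + ½i²η²Σ_{i≺j}[A′ᵢ,A′ⱼ] + (1/12)i³η³Σ_{i≺j}(…) + (1/6)i³η³Σ_{i≺j≺k}(…)}‖`
`≤ 52000·η⁴(Σ|A′ᵢ|)⁴` — the plaquette variable equals the exponential of the displayed cubic polynomial up to `O(η⁴|A′|⁴)`,
the form in which (34) enters (35)–(36). [cite: Balaban1985Variational, (34)–(35) p.283, (36) p.284] -/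
theorem eq34_prod_sub_exp_regime32 (A₁ A₂ A₃ A₄ : 𝔸) {η ε₂ : ℝ} (hη : 0 ≤ η) (hε : 32 * ε₂ ≤ 1)
    (h : η * (‖A₁‖ + ‖A₂‖ + ‖A₃‖ + ‖A₄‖) ≤ 4 * ε₂) :
    ‖exp (((Complex.I : ℂ) * η) • A₁) * exp (((Complex.I : ℂ) * η) • A₂) * exp (((Complex.I : ℂ) * η) • A₃) *
          exp (((Complex.I : ℂ) * η) • A₄) -
        exp (((Complex.I : ℂ) * η) • Z1 A₁ A₂ A₃ A₄ + (2 : ℂ)⁻¹ • ((Complex.I : ℂ) * η) ^ 2 • comm2 A₁ A₂ A₃ A₄ +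
          (12 : ℂ)⁻¹ • ((Complex.I : ℂ) * η) ^ 3 • comm3pair A₁ A₂ A₃ A₄ +
          (6 : ℂ)⁻¹ • ((Complex.I : ℂ) * η) ^ 3 • comm3triple A₁ A₂ A₃ A₄)‖ ≤
      52000 * η ^ 4 * (‖A₁‖ + ‖A₂‖ + ‖A₃‖ + ‖A₄‖) ^ 4 := by
  set c : ℂ := (Complex.I : ℂ) * η with hc
  have hsum : ‖c • A₁‖ + ‖c • A₂‖ + ‖c • A₃‖ + ‖c • A₄‖ = η * (‖A₁‖ + ‖A₂‖ + ‖A₃‖ + ‖A₄‖) := by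
    simp only [hc, norm_ieta_smul hη]; ring
  have hmain := prod_sub_exp_eighth (c • A₁) (c • A₂) (c • A₃) (c • A₄) (by rw [hsum]; linarith)
  rw [B11Eq31V4Bound.Z1_smul, B11Eq31V4Bound.comm2_smul, B11Eq31V4Bound.comm3pair_smul,
    B11Eq31V4Bound.comm3triple_smul, hsum] at hmain
  calc _ ≤ 52000 * (η * (‖A₁‖ + ‖A₂‖ + ‖A₃‖ + ‖A₄‖)) ^ 4 := hmain
    _ = 52000 * η ^ 4 * (‖A₁‖ + ‖A₂‖ + ‖A₃‖ + ‖A₄‖) ^ 4 := by ring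

variable {d : ℕ}

/-- The same at the plaquette letters `B11Eq34BCH.Aprime U₀ A μ ν x 0..3`. [cite: Balaban1985Variational, (34)–(35) p.283, (36) p.284] -/
theorem eq34_Aprime_prod_sub_exp_regime32 (U₀ : B7Prop1Explicit.Site d → Fin d → 𝔸ˣ)
    (A : B7Prop1Explicit.Site d → Fin d → 𝔸) (μ ν : Fin d) (x : B7Prop1Explicit.Site d) {η ε₂ : ℝ} (hη : 0 ≤ η)
    (hε : 32 * ε₂ ≤ 1)
    (h : η * (‖Aprime U₀ A μ ν x 0‖ + ‖Aprime U₀ A μ ν x 1‖ + ‖Aprime U₀ A μ ν x 2‖ + ‖Aprime U₀ A μ ν x 3‖)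
      ≤ 4 * ε₂) :
    ‖exp (((Complex.I : ℂ) * η) • Aprime U₀ A μ ν x 0) * exp (((Complex.I : ℂ) * η) • Aprime U₀ A μ ν x 1) *
          exp (((Complex.I : ℂ) * η) • Aprime U₀ A μ ν x 2) * exp (((Complex.I : ℂ) * η) • Aprime U₀ A μ ν x 3) -
        exp (((Complex.I : ℂ) * η) •
              Z1 (Aprime U₀ A μ ν x 0) (Aprime U₀ A μ ν x 1) (Aprime U₀ A μ ν x 2) (Aprime U₀ A μ ν x 3) +
          (2 : ℂ)⁻¹ • ((Complex.I : ℂ) * η) ^ 2 •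
              comm2 (Aprime U₀ A μ ν x 0) (Aprime U₀ A μ ν x 1) (Aprime U₀ A μ ν x 2) (Aprime U₀ A μ ν x 3) +
          (12 : ℂ)⁻¹ • ((Complex.I : ℂ) * η) ^ 3 •
              comm3pair (Aprime U₀ A μ ν x 0) (Aprime U₀ A μ ν x 1) (Aprime U₀ A μ ν x 2) (Aprime U₀ A μ ν x 3) +
          (6 : ℂ)⁻¹ • ((Complex.I : ℂ) * η) ^ 3 •
              comm3triple (Aprime U₀ A μ ν x 0) (Aprime U₀ A μ ν x 1) (Aprime U₀ A μ ν x 2)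
                (Aprime U₀ A μ ν x 3))‖ ≤
      52000 * η ^ 4 *
        (‖Aprime U₀ A μ ν x 0‖ + ‖Aprime U₀ A μ ν x 1‖ + ‖Aprime U₀ A μ ν x 2‖ + ‖Aprime U₀ A μ ν x 3‖) ^ 4 :=
  eq34_prod_sub_exp_regime32 _ _ _ _ hη hε h

end ProdSubExp

end Literature.MathematicalPhysics.QuantumFieldTheory.Balaban1983to89.B11Eq34Analytic
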